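import Literature.Analysis.FluidPDE.DecayingScalarIntegrationByParts
import Literature.Analysis.FluidPDE.DissipatesAtScale
import Literature.Analysis.FluidPDE.LerayHopf

/-!
# The energy inequality for a passive scalar in an `L²` divergence-free drift;
# `DissipatesAtScale u T x₀ r 1` for classical Leray–Hopf velocities

Topic `Literature/Analysis/FluidPDE`. For a jointly smooth, uniformly rapidly decaying scalar `θ`
solving the advection–diffusion equation `∂ₜθ + ⟪u, ∇θ⟫ = Δθ` on a slab `[a, b] × E` (one-sided
time derivative within `[a, b]`, the convention of `IsClassicalNSSolutionOn` and of
`DissipatesAtScale`), in a drift `u` that is, at each time of the slab, `C¹`, divergence free and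
square integrable, the `L²` energy `t ↦ ∫ θ(t)²` is nonincreasing on `[a, b]`
(Constantin–Kiselev–Ryzhik–Zlatoš 2008, §1: "`‖φ^A(·,t)‖_{L²}` is always non-increasing in `t`";
Majda–Bertozzi 2002, §3.1.1, the basic energy identity, scalar case). Consequently the scalar
dissipation factor of the route `SelfMixingDichotomy` is at most `1`: `DissipatesAtScale u T x₀ r δ`
holds for every `δ` with `1 ≤ δ²` as soon as the drift is of the above class on the window
`[T - r², T - r²/2]` — in particular for the velocity of a classical solution of Navier–Stokes on
`[0, T)` that is Leray–Hopf on `[0, T]`, whenever `r² ≤ T` (this is the statement listed as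
"deliberately NOT here" in `DissipatesAtScale.lean`). No decay of the drift is assumed: the
transport term is handled by `integral_mul_inner_gradient_eq_zero_of_memLp`
(`DecayingScalarIntegrationByParts`).

## Main statements (all proved)

* `antitoneOn_integral_sq_of_transport`: the energy-method skeleton (transport and dissipation
  pairings as hypotheses).
* `antitoneOn_integral_sq_of_isDivFree_memLp`: `t ↦ ∫ θ(t)²` is nonincreasing for a `C¹`,
  divergence-free, `L²` drift.
* `dissipatesAtScale_of_isDivFree_memLp`, `dissipatesAtScale_one_of_isDivFree_memLp`:
  `DissipatesAtScale u T x₀ r δ` for `1 ≤ δ²` (resp. `δ = 1`) for such drifts on the window.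
* `IsClassicalNSSolutionOn.dissipatesAtScale_of_isLerayHopfOn`: the same for classical
  Navier–Stokes velocities on `[0, T)` that are Leray–Hopf on `[0, T]`, `r² ≤ T`.

## References

* P. Constantin, A. Kiselev, L. Ryzhik, A. Zlatoš, *Diffusion and mixing in fluid flow*, Ann. of
  Math. 168 (2008), 643–674, §1. [ConstantinEtAl2008]
* A. J. Majda, A. L. Bertozzi, *Vorticity and Incompressible Flow*, CUP (2002), §3.1.1,
  Prop. 3.1. [MajdaBertozziCUP2002]
-/

noncomputable section

open MeasureTheory Set Function Filter Topology InnerProductSpace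
open scoped ContDiff Laplacian InnerProductSpace RealInnerProductSpace

namespace Literature.Analysis.FluidPDE

section General

variable {E : Type*} [NormedAddCommGroup E] [InnerProductSpace ℝ E] [FiniteDimensional ℝ E]
  [MeasurableSpace E] [BorelSpace E]

/-- **Energy method for a passive scalar (skeleton).** Let `θ` be jointly smooth with uniform rapid
decay on the slab `[a, b] × E` and solve `∂ₜθ + ⟪u, ∇θ⟫ = Δθ` there (one-sided time derivative
within `[a, b]`). If at every time of the slab the transport term integrates to zero and
`∫ θ Δθ ≤ 0`, then `t ↦ ∫ θ(t)²` is nonincreasing on `[a, b]`: `d/dt ∫ θ² = 2∫ θ ∂ₜθ =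
2∫ θ Δθ − 2∫ θ ⟪u, ∇θ⟫ ≤ 0` (differentiation under the integral sign on `(a, b)`, continuity on
`[a, b]`, monotonicity from the sign of the derivative). [folklore] -/
theorem antitoneOn_integral_sq_of_transport {a b : ℝ} (hab : a < b)
    {θ : ℝ → E → ℝ} {u : ℝ → E → E}
    (hθ : IsSmoothSpaceTimeOn (Set.Icc a b) θ) (hd : HasUniformRapidDecayOn (Set.Icc a b) θ)
    (hpde : ∀ t ∈ Set.Icc a b, ∀ x,
      timeDerivWithin (Set.Icc a b) θ t x + ⟪u t x, gradient (θ t) x⟫ = (Δ (θ t)) x)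
    (htr : ∀ t ∈ Set.Icc a b, ∫ x, θ t x * ⟪u t x, gradient (θ t) x⟫ = 0)
    (hlap : ∀ t ∈ Set.Icc a b, ∫ x, θ t x * (Δ (θ t)) x ≤ 0) :
    AntitoneOn (fun t => ∫ x, (θ t x) ^ 2) (Set.Icc a b) := by
  set S : Set ℝ := Icc a b with hS_def
  have hS : UniqueDiffOn ℝ S := uniqueDiffOn_Icc hab
  -- decay exponent and uniform decay constants for `θ`, `D²θ`, `∂ₜθ`
  set K : ℕ := Module.finrank ℝ E + 1 with hK
  have hr1 : (Module.finrank ℝ E : ℝ) < (K : ℝ) := by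
    rw [hK]; push_cast; linarith
  have hK0 : (0 : ℝ) ≤ (K : ℝ) := Nat.cast_nonneg _
  obtain ⟨A0, hA0, hA0b⟩ := hd.norm_le_rpow K
  obtain ⟨A2, hA2, hA2b⟩ := hd.norm_fderiv_fderiv_le_rpow hθ hS K
  obtain ⟨A3, hA3, hA3b⟩ := hd.norm_timeDerivWithin_le_rpow hθ hS K
  set C : ℝ := A0 + A2 + A3 with hC_def
  have hC : 0 ≤ C := by rw [hC_def]; positivity
  have h0 : ∀ s ∈ S, ∀ x, ‖θ s x‖ ≤ C * (1 + ‖x‖) ^ (-(K : ℝ)) := fun s hs x =>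
    le_decay_of_le_decay x (hA0b s hs x) (by rw [hC_def]; linarith)
  have h2 : ∀ s ∈ S, ∀ x, ‖fderiv ℝ (fderiv ℝ (θ s)) x‖ ≤ C * (1 + ‖x‖) ^ (-(K : ℝ)) :=
    fun s hs x => le_decay_of_le_decay x (hA2b s hs x) (by rw [hC_def]; linarith)
  have h3 : ∀ s ∈ S, ∀ x, ‖timeDerivWithin S θ s x‖ ≤ C * (1 + ‖x‖) ^ (-(K : ℝ)) :=
    fun s hs x => le_decay_of_le_decay x (hA3b s hs x) (by rw [hC_def]; linarith)
  -- the energy and the energy production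
  set e : ℝ → ℝ := fun s => ∫ x, (θ s x) ^ 2 with he_def
  set φ : ℝ → ℝ := fun s => ∫ x, 2 * (θ s x * timeDerivWithin S θ s x) with hφ_def
  -- continuity in `x` at fixed time, in `t` at fixed `x`
  have hθc : ∀ s ∈ S, Continuous (θ s) := fun s hs => hθ.continuous_slice hs
  have hθ'c : ∀ s ∈ S, Continuous (timeDerivWithin S θ s) := fun s hs =>
    hθ.continuous_timeDerivWithin hS hs
  have hθt_c : ∀ x, ContinuousOn (fun s => θ s x) S := fun x => hθ.continuousOn_time x
  have hΔc : ∀ s ∈ S, Continuous (fun x => (Δ (θ s)) x) := fun s hs =>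
    (hθ.laplacian hS).continuous_slice hs
  -- the dominating function
  set bound : E → ℝ := fun x => 2 * C * C * (1 + ‖x‖) ^ (-(K : ℝ)) with hbound_def
  have hbound : Integrable bound (volume : Measure E) := by
    have := (integrable_one_add_norm (E := E) (μ := volume) hr1).const_mul (2 * C * C)
    simpa [hbound_def] using this
  have hprod : ∀ s ∈ S, ∀ x, ∀ q : ℝ, ‖q‖ ≤ C * (1 + ‖x‖) ^ (-(K : ℝ)) →
      ‖θ s x‖ * ‖q‖ ≤ C * C * (1 + ‖x‖) ^ (-(K : ℝ)) := by
    intro s hs x q hq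
    calc ‖θ s x‖ * ‖q‖ ≤ C * (1 + ‖x‖) ^ (-(K : ℝ)) * (C * (1 + ‖x‖) ^ (-(K : ℝ))) :=
          mul_le_mul (h0 s hs x) hq (norm_nonneg _) (by positivity)
      _ ≤ C * 1 * (C * (1 + ‖x‖) ^ (-(K : ℝ))) := by
          gcongr; exact rpow_neg_le_one x hK0
      _ = C * C * (1 + ‖x‖) ^ (-(K : ℝ)) := by ring
  have hFle : ∀ s ∈ S, ∀ x, ‖(θ s x) ^ 2‖ ≤ bound x := by
    intro s hs x
    rw [norm_pow, sq, hbound_def]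
    have h1 := hprod s hs x (θ s x) (h0 s hs x)
    have h2' : 0 ≤ C * C * (1 + ‖x‖) ^ (-(K : ℝ)) := by positivity
    nlinarith
  have hF'le : ∀ s ∈ S, ∀ x, ‖2 * (θ s x * timeDerivWithin S θ s x)‖ ≤ bound x := by
    intro s hs x
    rw [norm_mul, Real.norm_two, norm_mul, hbound_def]
    have h1 := hprod s hs x (timeDerivWithin S θ s x) (h3 s hs x)
    nlinarith
  have hIe : ∀ s ∈ S, Integrable (fun x => (θ s x) ^ 2) (volume : Measure E) := fun s hs =>
    Integrable.mono' hbound ((hθc s hs).pow 2).aestronglyMeasurable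
      (Eventually.of_forall (hFle s hs))
  -- (B1) the energy is continuous on `[a, b]`
  have hB1 : ContinuousOn e S := by
    refine continuousOn_of_dominated (bound := bound) (fun s hs => ?_) (fun s hs => ?_) hbound ?_
    · exact ((hθc s hs).pow 2).aestronglyMeasurable
    · exact Eventually.of_forall (hFle s hs)
    · exact Eventually.of_forall fun x => (hθt_c x).pow 2
  -- (B2) the energy is differentiable on `(a, b)` with derivative `φ`
  have hB2 : ∀ s ∈ Ioo a b, HasDerivAt e (φ s) s := by
    intro s hs
    have hsS : s ∈ S := Ioo_subset_Icc_self hs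
    have hIoo : Ioo a b ∈ 𝓝 s := Ioo_mem_nhds hs.1 hs.2
    have key := hasDerivAt_integral_of_dominated_loc_of_deriv_le (μ := (volume : Measure E))
      (F := fun σ x => (θ σ x) ^ 2) (F' := fun σ x => 2 * (θ σ x * timeDerivWithin S θ σ x))
      (x₀ := s) (bound := bound) hIoo ?_ (hIe s hsS) ?_ ?_ hbound ?_
    · exact key.2
    · filter_upwards [hIoo] with σ hσ
      exact ((hθc σ (Ioo_subset_Icc_self hσ)).pow 2).aestronglyMeasurable
    · exact (continuous_const.mul ((hθc s hsS).mul (hθ'c s hsS))).aestronglyMeasurable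
    · exact Eventually.of_forall fun x σ hσ => hF'le σ (Ioo_subset_Icc_self hσ) x
    · refine Eventually.of_forall fun x σ hσ => ?_
      have hσS : σ ∈ S := Ioo_subset_Icc_self hσ
      have hSσ : S ∈ 𝓝 σ := Icc_mem_nhds hσ.1 hσ.2
      have h1 : HasDerivAt (fun τ => θ τ x) (timeDerivWithin S θ σ x) σ :=
        (hθ.hasDerivWithinAt_timeDerivWithin hS hσS x).hasDerivAt hSσ
      have h2' : HasDerivAt (fun τ => θ τ x * θ τ x)
          (timeDerivWithin S θ σ x * θ σ x + θ σ x * timeDerivWithin S θ σ x) σ :=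
        h1.fun_mul h1
      have hfeq : (fun τ => θ τ x ^ 2) = fun τ => θ τ x * θ τ x := funext fun τ => sq _
      show HasDerivAt (fun τ => θ τ x ^ 2) (2 * (θ σ x * timeDerivWithin S θ σ x)) σ
      rw [hfeq]
      exact h2'.congr_deriv (by ring)
  -- (B3) the sign of the energy production: `φ ≤ 0` on `[a, b]`
  have hB3 : ∀ s ∈ S, φ s ≤ 0 := by
    intro s hs
    -- the equation, solved for the time derivative
    have hpt : ∀ x, timeDerivWithin S θ s x = (Δ (θ s)) x - ⟪u s x, gradient (θ s) x⟫ :=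
      fun x => eq_sub_of_add_eq (hpde s hs x)
    -- integrability of `θ Δθ` and `θ ∂ₜθ`, hence of the transport pairing
    have hIΔ : Integrable (fun x => θ s x * (Δ (θ s)) x) (volume : Measure E) := by
      refine integrable_of_norm_le_decay_mul_decay (C₁ := C) (C₂ := Module.finrank ℝ E * C)
        (r := K) (r' := K) ((hθc s hs).mul (hΔc s hs)) hr1 hK0 hC (by positivity) fun x => ?_
      rw [norm_mul]
      refine mul_le_mul (h0 s hs x) ((norm_laplacian_le (θ s) x).trans ?_) (norm_nonneg _)
        (by positivity)
      rw [mul_assoc]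
      gcongr
      exact h2 s hs x
    have hIt : Integrable (fun x => θ s x * timeDerivWithin S θ s x) (volume : Measure E) := by
      refine integrable_of_norm_le_decay_mul_decay (C₁ := C) (C₂ := C) (r := K) (r' := K)
        ((hθc s hs).mul (hθ'c s hs)) hr1 hK0 hC hC fun x => ?_
      rw [norm_mul]
      exact mul_le_mul (h0 s hs x) (h3 s hs x) (norm_nonneg _) (by positivity)
    have hfun : (fun x => θ s x * ⟪u s x, gradient (θ s) x⟫) =
        fun x => θ s x * (Δ (θ s)) x - θ s x * timeDerivWithin S θ s x := by
      funext x
      rw [hpt x]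
      ring
    have hItr : Integrable (fun x => θ s x * ⟪u s x, gradient (θ s) x⟫) (volume : Measure E) := by
      rw [hfun]
      exact hIΔ.sub' hIt
    -- `φ s = 2 (∫ θ Δθ - ∫ θ ⟪u, ∇θ⟫) = 2 ∫ θ Δθ ≤ 0`
    have hφs : φ s =
        2 * ((∫ x, θ s x * (Δ (θ s)) x) - ∫ x, θ s x * ⟪u s x, gradient (θ s) x⟫) := by
      calc φ s = 2 * ∫ x, θ s x * timeDerivWithin S θ s x := integral_const_mul _ _
        _ = 2 * ∫ x, (θ s x * (Δ (θ s)) x - θ s x * ⟪u s x, gradient (θ s) x⟫) := by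
            congr 1
            refine integral_congr_ae (Eventually.of_forall fun x => ?_)
            simp only [hpt x]
            ring
        _ = _ := by rw [integral_sub hIΔ hItr]
    rw [hφs, htr s hs, sub_zero]
    have := hlap s hs
    linarith
  -- monotonicity from the sign of the derivative
  refine antitoneOn_of_deriv_nonpos (convex_Icc a b) hB1 ?_ ?_
  · rw [interior_Icc]
    exact fun s hs => (hB2 s hs).differentiableAt.differentiableWithinAt
  · rw [interior_Icc]
    intro s hs
    rw [(hB2 s hs).deriv]
    exact hB3 s (Ioo_subset_Icc_self hs)


/-- **`L²` energy inequality for a passive scalar in a `C¹`, divergence-free, `L²` drift.** Let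
`θ` be jointly smooth with uniform rapid decay on `[a, b] × E`, `a < b`, solving
`∂ₜθ + ⟪u, ∇θ⟫ = Δθ` there, where for each `t ∈ [a, b]` the drift `u t` is `C¹`, divergence free
and square integrable (no decay of `u` is assumed). Then `t ↦ ∫ θ(t)²` is nonincreasing on
`[a, b]` (Constantin–Kiselev–Ryzhik–Zlatoš 2008, §1; Majda–Bertozzi §3.1.1): the transport
pairing vanishes by `integral_mul_inner_gradient_eq_zero_of_memLp` and the dissipation pairing is
nonpositive by `integral_mul_laplacian_self_nonpos`. [cite: ConstantinEtAl2008, §1 (L² norm of a passive scalar is non-increasing)] -/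
theorem antitoneOn_integral_sq_of_isDivFree_memLp {a b : ℝ} (hab : a < b)
    {θ : ℝ → E → ℝ} {u : ℝ → E → E}
    (hθ : IsSmoothSpaceTimeOn (Set.Icc a b) θ) (hd : HasUniformRapidDecayOn (Set.Icc a b) θ)
    (hpde : ∀ t ∈ Set.Icc a b, ∀ x,
      timeDerivWithin (Set.Icc a b) θ t x + ⟪u t x, gradient (θ t) x⟫ = (Δ (θ t)) x)
    (hu1 : ∀ t ∈ Set.Icc a b, ContDiff ℝ 1 (u t))
    (hdiv : ∀ t ∈ Set.Icc a b, VectorCalculus.IsDivFree (u t))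
    (hu2 : ∀ t ∈ Set.Icc a b, MemLp (u t) 2 (volume : Measure E)) :
    AntitoneOn (fun t => ∫ x, (θ t x) ^ 2) (Set.Icc a b) := by
  have hS : UniqueDiffOn ℝ (Set.Icc a b) := uniqueDiffOn_Icc hab
  -- uniform decay constants for `θ`, `Dθ`, `D²θ` with exponent `K = dim E + 1`
  set K : ℕ := Module.finrank ℝ E + 1 with hK
  have hr : (Module.finrank ℝ E : ℝ) < (K : ℝ) := by rw [hK]; push_cast; linarith
  obtain ⟨A0, hA0, hA0b⟩ := hd.norm_le_rpow K
  obtain ⟨A1, hA1, hA1b⟩ := hd.norm_fderiv_le_rpow hθ hS K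
  obtain ⟨A2, hA2, hA2b⟩ := hd.norm_fderiv_fderiv_le_rpow hθ hS K
  set C : ℝ := A0 + A1 + A2 with hC_def
  have hC : 0 ≤ C := by rw [hC_def]; positivity
  have h0 : ∀ s ∈ Set.Icc a b, ∀ x, ‖θ s x‖ ≤ C * (1 + ‖x‖) ^ (-(K : ℝ)) := fun s hs x =>
    le_decay_of_le_decay x (hA0b s hs x) (by rw [hC_def]; linarith)
  have h1 : ∀ s ∈ Set.Icc a b, ∀ x, ‖fderiv ℝ (θ s) x‖ ≤ C * (1 + ‖x‖) ^ (-(K : ℝ)) :=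
    fun s hs x => le_decay_of_le_decay x (hA1b s hs x) (by rw [hC_def]; linarith)
  have h2 : ∀ s ∈ Set.Icc a b, ∀ x, ‖fderiv ℝ (fderiv ℝ (θ s)) x‖ ≤ C * (1 + ‖x‖) ^ (-(K : ℝ)) :=
    fun s hs x => le_decay_of_le_decay x (hA2b s hs x) (by rw [hC_def]; linarith)
  refine antitoneOn_integral_sq_of_transport hab hθ hd hpde (fun t ht => ?_) (fun t ht => ?_)
  · exact integral_mul_inner_gradient_eq_zero_of_memLp (hu1 t ht) (hdiv t ht) (hu2 t ht)
      (contDiff_infty.1 (hθ.contDiff_slice ht) 1) hC hr (h0 t ht) (h1 t ht)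
  · exact integral_mul_laplacian_self_nonpos (contDiff_infty.1 (hθ.contDiff_slice ht) 2) hC hr
      (h0 t ht) (h1 t ht) (h2 t ht)

end General

/-! ### The scalar dissipation factor is at most one -/

section Dissipates

variable {u : ℝ → EuclideanSpace ℝ (Fin 3) → EuclideanSpace ℝ (Fin 3)} {T : ℝ}
  {x₀ : EuclideanSpace ℝ (Fin 3)} {r δ : ℝ}

/-- **`DissipatesAtScale u T x₀ r δ` for `1 ≤ δ²`, for a `C¹`, divergence-free, `L²` drift on the
window.** If at every time of the window `[T - r², T - r²/2]` the drift `u t` is `C¹`, divergence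
free and square integrable, then every admissible scalar keeps at most its initial `L²` mass after
half a diffusive time, so the drift dissipates at scale `r` with every factor `δ`, `1 ≤ δ²`
(`antitoneOn_integral_sq_of_isDivFree_memLp`; for `r = 0` the predicate is vacuous,
`dissipatesAtScale_zero_radius`). The support condition on the datum is not used. [cite: ConstantinEtAl2008, §1 (L² norm of a passive scalar is non-increasing)] -/
theorem dissipatesAtScale_of_isDivFree_memLp (hδ : 1 ≤ δ ^ 2)
    (hu1 : ∀ t ∈ Set.Icc (T - r ^ 2) (T - r ^ 2 / 2), ContDiff ℝ 1 (u t))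
    (hdiv : ∀ t ∈ Set.Icc (T - r ^ 2) (T - r ^ 2 / 2), VectorCalculus.IsDivFree (u t))
    (hu2 : ∀ t ∈ Set.Icc (T - r ^ 2) (T - r ^ 2 / 2), MemLp (u t) 2 (volume : Measure _)) :
    DissipatesAtScale u T x₀ r δ := by
  by_cases hr : r = 0
  · subst hr; exact dissipatesAtScale_zero_radius
  have hab : T - r ^ 2 < T - r ^ 2 / 2 := by
    have : 0 < r ^ 2 := by positivity
    linarith
  intro θ hs hd he _hsupp
  have hanti := antitoneOn_integral_sq_of_isDivFree_memLp hab hs hd he hu1 hdiv hu2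
  have hle : ∫ x, (θ (T - r ^ 2 / 2) x) ^ 2 ≤ ∫ x, (θ (T - r ^ 2) x) ^ 2 :=
    hanti (Set.left_mem_Icc.2 hab.le) (Set.right_mem_Icc.2 hab.le) hab.le
  have hnn : 0 ≤ ∫ x, (θ (T - r ^ 2) x) ^ 2 := integral_nonneg fun _ => sq_nonneg _
  calc ∫ x, (θ (T - r ^ 2 / 2) x) ^ 2 ≤ 1 * ∫ x, (θ (T - r ^ 2) x) ^ 2 := by rwa [one_mul]
    _ ≤ δ ^ 2 * ∫ x, (θ (T - r ^ 2) x) ^ 2 := mul_le_mul_of_nonneg_right hδ hnn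

/-- **`DissipatesAtScale u T x₀ r 1`** for a drift that is `C¹`, divergence free and square
integrable at every time of the window `[T - r², T - r²/2]`: the `L²` norm of a passive scalar is
nonincreasing. [cite: ConstantinEtAl2008, §1 (L² norm of a passive scalar is non-increasing)] -/
theorem dissipatesAtScale_one_of_isDivFree_memLp
    (hu1 : ∀ t ∈ Set.Icc (T - r ^ 2) (T - r ^ 2 / 2), ContDiff ℝ 1 (u t))
    (hdiv : ∀ t ∈ Set.Icc (T - r ^ 2) (T - r ^ 2 / 2), VectorCalculus.IsDivFree (u t))
    (hu2 : ∀ t ∈ Set.Icc (T - r ^ 2) (T - r ^ 2 / 2), MemLp (u t) 2 (volume : Measure _)) :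
    DissipatesAtScale u T x₀ r 1 :=
  dissipatesAtScale_of_isDivFree_memLp (by norm_num) hu1 hdiv hu2

/-- **The dissipation factor of a classical Leray–Hopf velocity is at most one.** Let `(u, p)` be a
classical solution of the Navier–Stokes system (any viscosity `ν` and force `f`) on `E × [0, T)`
whose velocity is Leray–Hopf on `[0, T]` (so `u t ∈ L²` for every `t ∈ [0, T]`), and let
`r² ≤ T`. Then `DissipatesAtScale u T x₀ r δ` for every `x₀` and every `δ` with `1 ≤ δ²`: on the
window `[T - r², T - r²/2] ⊆ [0, T)` each slice `u t` is smooth, divergence free and square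
integrable. In the items of route `SelfMixingDichotomy` this makes "not `δ`-mixing at scale `r`"
impossible for `δ ≥ 1` and `r² ≤ T`. [cite: ConstantinEtAl2008, §1 (L² norm of a passive scalar is non-increasing)] -/
theorem IsClassicalNSSolutionOn.dissipatesAtScale_of_isLerayHopfOn {ν : ℝ}
    {f : ℝ → EuclideanSpace ℝ (Fin 3) → EuclideanSpace ℝ (Fin 3)}
    {p : ℝ → EuclideanSpace ℝ (Fin 3) → ℝ}
    (hcl : IsClassicalNSSolutionOn (Set.Ico 0 T) ν f u p) (hLH : IsLerayHopfOn T ν f (u 0) u)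
    (hrT : r ^ 2 ≤ T) (hδ : 1 ≤ δ ^ 2) (x₀ : EuclideanSpace ℝ (Fin 3)) :
    DissipatesAtScale u T x₀ r δ := by
  by_cases hr : r = 0
  · subst hr; exact dissipatesAtScale_zero_radius
  have hr2 : 0 < r ^ 2 := by positivity
  have hwin : ∀ t ∈ Set.Icc (T - r ^ 2) (T - r ^ 2 / 2), t ∈ Set.Ico 0 T ∧ t ∈ Set.Icc 0 T := by
    intro t ht
    exact ⟨⟨by linarith [ht.1], by linarith [ht.2]⟩, ⟨by linarith [ht.1], by linarith [ht.2]⟩⟩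
  refine dissipatesAtScale_of_isDivFree_memLp hδ (fun t ht => ?_) (fun t ht => ?_) (fun t ht => ?_)
  · exact contDiff_infty.1 (hcl.contDiff_velocity (hwin t ht).1) 1
  · exact hcl.divFree t (hwin t ht).1
  · exact hLH.memLp t (hwin t ht).2

end Dissipates

end Literature.Analysis.FluidPDE
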